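import Summits.BirchSwinnertonDyer.BirchSwinnertonDyer.Theorems.PrintCFramBottomClassIndexLawFiveLeBernoulliKummerDictionaryClass
import Literature.NumberTheory.EllipticCurves.BSDRootNumberSmallConductorProofs
import Literature.NumberTheory.EllipticCurves.KrizLi2019.TeichmullerCharacterExists
import HarnessLib

/-!
# Crux `PrintCFram.BottomClassIndexLawFiveLe` (stmt-BirchSwinnertonDyer-20372), line `eisenstein-resource-bdp-line` (registry v18):
# THE RESEARCH STUBS IN GENERALIZED-BERNOULLI CURRENCY — B1, B2′ and kriz-li-cover's Stub C are each KERNEL-EQUIVALENT to the same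
# statement with the Kriz–Li Bernoulli hypothesis replaced by `p ∣ B_{p−k,χ_e}/(p−k)` resp. `p ∣ B_{k,χ_eε_{K''}}/k`
# (cell `bsd-print-cfram`, width seat `bsd-line-cfram-p1-w8` g3; THEOREMS ONLY, `--supports` 20372; BSD is not proved by any of this)

HONEST FRAMING. Nothing here is a statement about BSD; no stub is closed, nothing is weakened or strengthened: three `Iff`s between the
registered texts (registry v18 `stub_bsdp_of_classFactor` = B1, `stub_bsdp_of_noAdmissibleHeegnerField` = B2′; the publish-only line
`kriz-li-cover`'s `stub_heegnerField_of_unitClassFactor` = C — all three restated VERBATIM as the left-hand sides below) and their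
GENERALIZED-BERNOULLI forms, in which the odd datum `(f, ψ, ω)` with the trace form is replaced by the class data `(m, χ_e, ε, k)` of
`KrizLiBinders.exists_krizLiData_of_cmRamified` (χ_e primitive quadratic mod `m ⊥ p`, `2 ≤ k ≤ p − 2`, `χ_e(−1)(−1)^k = −1`, trace form
`a_ℓ(W) ≡ ε(ℓ)(ℓ^k + ℓ^{p−k})`, good reduction off `pm`) and the Bernoulli hypotheses by
`‖((p−k):ℚ_p)⁻¹ B_{p−k,χ_e}‖ ≤ p⁻¹` (class factor) / `‖(k:ℚ_p)⁻¹ B_{k,(χ_e↑ε_K↑)~}‖ ≤ p⁻¹` (field factor). The engine is the Kummer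
dictionary of Parts I–II (`KummerDictionary.norm_bernoulliOnePrim_inv_le_inv_iff_of_hss`, `…_bernoulliCharTwo_le_inv_iff_of_heegner`,
`…psi_apply_eq_classCharacter_of_hss`) and, for the direction «Bernoulli form ⟹ registered form», the class character `ψ_c = χ↑(ω^k)↑`
itself (`KrizLiBinders.krizLiBinders_of_data`, `KrizLi2019.exists_isTeichmullerCharacter`).

* `stubB1_iff_bernoulli` — B1 ⟺ «class data ∧ `r_an = 1` ∧ `p ∣ B_{p−k,χ_e}/(p−k)` ⟹ `BSD_p`».
* `stubB2'_iff_bernoulli` — B2′ ⟺ «class data ∧ `r_an = 1` ∧ `p ∤ B_{p−k,χ_e}/(p−k)` ∧ (every imaginary quadratic Heegner `K''` with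
  `d` odd `< −4` and every Kronecker `ε_K` has `p ∣ B_{k,(χ_e↑ε_K↑)~}/k`) ⟹ `BSD_p`».
* `stubC_iff_bernoulli` — C ⟺ «class data ∧ `r_an = 1` ∧ `p ∤ B_{p−k,χ_e}/(p−k)` ⟹ ∃ such `K''`, `ε_K` with `p ∤ B_{k,(χ_e↑ε_K↑)~}/k`»
  — the statement bsd-idea-7 g12's census engine and the kit job of `Lines/kriz-li-cover-P3-jobspec.md` test numerically
  (`B_{m,χ_G} mod p`), now the kernel-exact target.

beyond-print theorem: NO. References: [KrizLi2019] Thm. 1.20, §8; [Washington1997] Thm. 5.11, Cor. 5.13; registry v18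
`Cruxes/BottomClassIndexLawFiveLe/Lines/eisenstein_resource_bdp_line.lean`; `Lines/kriz_li_cover.lean` v2.1.
-/

set_option autoImplicit false
-- summit-side namespace `Summit.BirchSwinnertonDyer.BirchSwinnertonDyer.…` (single-conjunct summit, D-0017 layout)
set_option linter.dupNamespace false

noncomputable section

open scoped Classical
open NumberField WeierstrassCurve DirichletCharacter Literature.NumberTheory.LFunctions
  Literature.NumberTheory.EllipticCurves Literature.NumberTheory.EllipticCurves.KrizLi2019
  Literature.NumberTheory.EllipticCurves.Rank1Residual
open Literature.NumberTheory.Congruences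

namespace Summit.BirchSwinnertonDyer.BirchSwinnertonDyer.Theorems.PrintCFram.KummerDictionary

open Summit.BirchSwinnertonDyer.BirchSwinnertonDyer.Theorems.PrintCFram
open Summit.BirchSwinnertonDyer.Rank1Residual.X12.O11

/-! ## §1 B1 `stub_bsdp_of_classFactor` -/

/-- **B1 ⟺ B1 in Bernoulli currency.** Left: registry v18's `stub_bsdp_of_classFactor` VERBATIM. Right: the same with the odd datum
`(f, ψ, ω)` + `hss` + `‖B_{1,ψ⁻¹~}‖ ≤ p⁻¹` replaced by class data `(m, χ_e, ε, k)` + `‖B_{p−k,χ_e}/(p−k)‖ ≤ p⁻¹`.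
[cite: KrizLi2019, Thm. 1.20 (p. 8, the Bernoulli hypothesis)] [cite: Washington1997, Thm. 5.11 and Cor. 5.13] -/
theorem stubB1_iff_bernoulli :
    (∀ (W : WeierstrassCurve ℚ) [W.IsElliptic] [W.IsGloballyMinimal] (p : ℕ) [Fact p.Prime],
      W.HasCM → CMRamified W p → 5 ≤ p → W.analyticRank = 1 →
      ∀ (f : ℕ) [NeZero f] (ψ : DirichletCharacter ℚ_[p] f) (ω : DirichletCharacter ℚ_[p] p),
        ψ.Odd → IsTeichmullerCharacter ω →
        (∀ ℓ : ℕ, ℓ.Prime → ¬ (ℓ ∣ p * W.conductorNorm ℤ) →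
          ‖((W.LFunction ℓ : ℤ) : ℚ_[p]) - (ψ (ℓ : ZMod f) + ψ⁻¹ (ℓ : ZMod f) * ω (ℓ : ZMod p))‖ < 1) →
        ‖bernoulliOnePrim ψ⁻¹‖ ≤ (p : ℝ)⁻¹ →
        BSDp W p) ↔
    (∀ (W : WeierstrassCurve ℚ) [W.IsElliptic] [W.IsGloballyMinimal] (p : ℕ) [Fact p.Prime],
      W.HasCM → CMRamified W p → 5 ≤ p → W.analyticRank = 1 →
      ∀ (m : ℕ) [NeZero m] (χ : DirichletCharacter ℚ_[p] m) (ε : ℕ → ℤ) (k : ℕ),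
        m.Coprime p → χ.IsPrimitive → χ.IsQuadratic → (∀ ℓ : ℕ, ℓ.Prime → ℓ ≠ p → χ (ℓ : ZMod m) = (ε ℓ : ℚ_[p])) →
        2 ≤ k → k ≤ p - 2 → χ (-1) * (-1) ^ k = -1 →
        (∀ ℓ : ℕ, ℓ.Prime → ℓ ≠ p →
          ((W.LFunction ℓ : ℤ) : ZMod p) = (ε ℓ : ZMod p) * ((ℓ : ZMod p) ^ k + (ℓ : ZMod p) ^ (p - k))) →
        (∀ ℓ : ℕ, (hℓ : ℓ.Prime) → ℓ ≠ p → ¬ ℓ ∣ m → (haveI := Fact.mk hℓ; W.HasGoodReductionAtPrime ℓ)) →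
        ‖((p - k : ℕ) : ℚ_[p])⁻¹ * generalizedBernoulli (p - k) χ‖ ≤ (p : ℝ)⁻¹ →
        BSDp W p) := by
  constructor
  · intro hB1 W _ _ p _ hCM hram h5 hr m _ χ ε k hmp hχ hχq hε hk2 hkp hpar htr hgoodW hB
    have hp2 : p ≠ 2 := by omega
    haveI : NeZero (p * m) := ⟨Nat.mul_ne_zero (Fact.out : p.Prime).ne_zero (NeZero.ne m)⟩
    obtain ⟨ω, hω⟩ := exists_isTeichmullerCharacter (p := p)
    obtain ⟨-, hssc, -, -⟩ := KrizLiBinders.krizLiBinders_of_data hp2 W χ hχ hχq hmp ε hε hk2 hkp htr hgoodW ω hω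
    have hodd := KrizLiBinders.psi_odd_of ω χ k hp2 hω (by omega) hpar
    exact hB1 W p hCM hram h5 hr (p * m) _ ω hodd hω hssc
      ((norm_bernoulliOnePrim_inv_le_inv_iff_of_hss W χ ε k ω _ h5 hχ hχq hmp hε hk2 hkp hpar htr hgoodW hω hodd hssc).mpr hB)
  · intro hB W _ _ p _ hCM hram h5 hr f _ ψ ω hψ hω hss hcls
    obtain ⟨m, hm, χ, ε, k, hmp, hχ, hχq, hε, -, hk2, hkp, hpar, htr, hgoodW⟩ :=
      KrizLiBinders.exists_krizLiData_of_cmRamified W hCM hram h5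
    haveI := hm
    exact hB W p hCM hram h5 hr m χ ε k hmp hχ hχq (fun ℓ _ _ ↦ hε ℓ) hk2 hkp hpar htr hgoodW
      ((norm_bernoulliOnePrim_inv_le_inv_iff_of_hss W χ ε k ω ψ h5 hχ hχq hmp (fun ℓ _ _ ↦ hε ℓ) hk2 hkp hpar htr hgoodW
        hω hψ hss).mp hcls)

/-! ## §2 B2′ `stub_bsdp_of_noAdmissibleHeegnerField` -/

/-- **B2′ ⟺ B2′ in Bernoulli currency.** Left: registry v18's `stub_bsdp_of_noAdmissibleHeegnerField` VERBATIM. Right: class data,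
unit class factor `¬ ‖B_{p−k,χ_e}/(p−k)‖ ≤ p⁻¹`, and for every imaginary quadratic `K''` Heegner for `N_W` with `d` odd `< −4` and every
Kronecker `ε_K`: `‖B_{k,(χ_e↑ε_K↑)~}/k‖ ≤ p⁻¹`. [cite: KrizLi2019, Thm. 1.20 (p. 8)] [cite: Washington1997, Thm. 5.11 and Cor. 5.13] -/
theorem stubB2'_iff_bernoulli :
    (∀ (W : WeierstrassCurve ℚ) [W.IsElliptic] [W.IsGloballyMinimal] (p : ℕ) [Fact p.Prime],
      W.HasCM → CMRamified W p → 5 ≤ p → W.analyticRank = 1 →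
      ∀ (f : ℕ) [NeZero f] (ψ : DirichletCharacter ℚ_[p] f) (ω : DirichletCharacter ℚ_[p] p),
        ψ.Odd → IsTeichmullerCharacter ω →
        (∀ ℓ : ℕ, ℓ.Prime → ¬ (ℓ ∣ p * W.conductorNorm ℤ) →
          ‖((W.LFunction ℓ : ℤ) : ℚ_[p]) - (ψ (ℓ : ZMod f) + ψ⁻¹ (ℓ : ZMod f) * ω (ℓ : ZMod p))‖ < 1) →
        ¬ ‖bernoulliOnePrim ψ⁻¹‖ ≤ (p : ℝ)⁻¹ →
        (∀ (K : Type) [Field K] [NumberField K], IsImaginaryQuadratic K → SatisfiesHeegnerHypothesis (W.conductorNorm ℤ) K →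
          Odd (NumberField.discr K) → NumberField.discr K < -4 →
          ∀ εK : DirichletCharacter ℚ_[p] (NumberField.discr K).natAbs, IsKroneckerCharacterOf K εK →
            ‖bernoulliOnePrim (bernoulliCharTwo ψ εK ω)‖ ≤ (p : ℝ)⁻¹) →
        BSDp W p) ↔
    (∀ (W : WeierstrassCurve ℚ) [W.IsElliptic] [W.IsGloballyMinimal] (p : ℕ) [Fact p.Prime],
      W.HasCM → CMRamified W p → 5 ≤ p → W.analyticRank = 1 →
      ∀ (m : ℕ) [NeZero m] (χ : DirichletCharacter ℚ_[p] m) (ε : ℕ → ℤ) (k : ℕ),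
        m.Coprime p → χ.IsPrimitive → χ.IsQuadratic → (∀ ℓ : ℕ, ℓ.Prime → ℓ ≠ p → χ (ℓ : ZMod m) = (ε ℓ : ℚ_[p])) →
        2 ≤ k → k ≤ p - 2 → χ (-1) * (-1) ^ k = -1 →
        (∀ ℓ : ℕ, ℓ.Prime → ℓ ≠ p →
          ((W.LFunction ℓ : ℤ) : ZMod p) = (ε ℓ : ZMod p) * ((ℓ : ZMod p) ^ k + (ℓ : ZMod p) ^ (p - k))) →
        (∀ ℓ : ℕ, (hℓ : ℓ.Prime) → ℓ ≠ p → ¬ ℓ ∣ m → (haveI := Fact.mk hℓ; W.HasGoodReductionAtPrime ℓ)) →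
        ¬ ‖((p - k : ℕ) : ℚ_[p])⁻¹ * generalizedBernoulli (p - k) χ‖ ≤ (p : ℝ)⁻¹ →
        (∀ (K : Type) [Field K] [NumberField K], IsImaginaryQuadratic K → SatisfiesHeegnerHypothesis (W.conductorNorm ℤ) K →
          Odd (NumberField.discr K) → NumberField.discr K < -4 →
          ∀ εK : DirichletCharacter ℚ_[p] (NumberField.discr K).natAbs, IsKroneckerCharacterOf K εK →
            ‖(k : ℚ_[p])⁻¹ * @generalizedBernoulli ℚ_[p] _ _
              (changeLevel (dvd_mul_right m (NumberField.discr K).natAbs) χ *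
                changeLevel (dvd_mul_left (NumberField.discr K).natAbs m) εK).conductor ⟨conductor_ne_zero _⟩ k
              (changeLevel (dvd_mul_right m (NumberField.discr K).natAbs) χ *
                changeLevel (dvd_mul_left (NumberField.discr K).natAbs m) εK).primitiveCharacter‖ ≤ (p : ℝ)⁻¹) →
        BSDp W p) := by
  constructor
  · intro hB2 W _ _ p _ hCM hram h5 hr m _ χ ε k hmp hχ hχq hε hk2 hkp hpar htr hgoodW hcls hall
    have hp2 : p ≠ 2 := by omega
    haveI : NeZero (p * m) := ⟨Nat.mul_ne_zero (Fact.out : p.Prime).ne_zero (NeZero.ne m)⟩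
    obtain ⟨ω, hω⟩ := exists_isTeichmullerCharacter (p := p)
    obtain ⟨-, hssc, -, -⟩ := KrizLiBinders.krizLiBinders_of_data hp2 W χ hχ hχq hmp ε hε hk2 hkp htr hgoodW ω hω
    have hodd := KrizLiBinders.psi_odd_of ω χ k hp2 hω (by omega) hpar
    refine hB2 W p hCM hram h5 hr (p * m) _ ω hodd hω hssc
      (fun h ↦ hcls ((norm_bernoulliOnePrim_inv_le_inv_iff_of_hss W χ ε k ω _ h5 hχ hχq hmp hε hk2 hkp hpar htr hgoodW hω
        hodd hssc).mp h)) fun K _ _ hK hH hoddK hd4 εK hεK ↦ ?_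
    exact (norm_bernoulliOnePrim_bernoulliCharTwo_le_inv_iff_of_heegner W χ ε k ω _ hCM hram h5 hχ hχq hmp hε hk2 hkp hpar htr
      hgoodW hω hodd hssc K hK hH εK).mpr (hall K hK hH hoddK hd4 εK hεK)
  · intro hB W _ _ p _ hCM hram h5 hr f _ ψ ω hψ hω hss hcls hall
    obtain ⟨m, hm, χ, ε, k, hmp, hχ, hχq, hε, -, hk2, hkp, hpar, htr, hgoodW⟩ :=
      KrizLiBinders.exists_krizLiData_of_cmRamified W hCM hram h5
    haveI := hm
    refine hB W p hCM hram h5 hr m χ ε k hmp hχ hχq (fun ℓ _ _ ↦ hε ℓ) hk2 hkp hpar htr hgoodW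
      (fun h ↦ hcls ((norm_bernoulliOnePrim_inv_le_inv_iff_of_hss W χ ε k ω ψ h5 hχ hχq hmp (fun ℓ _ _ ↦ hε ℓ) hk2 hkp hpar
        htr hgoodW hω hψ hss).mpr h)) fun K _ _ hK hH hoddK hd4 εK hεK ↦ ?_
    exact (norm_bernoulliOnePrim_bernoulliCharTwo_le_inv_iff_of_heegner W χ ε k ω ψ hCM hram h5 hχ hχq hmp (fun ℓ _ _ ↦ hε ℓ)
      hk2 hkp hpar htr hgoodW hω hψ hss K hK hH εK).mp (hall K hK hH hoddK hd4 εK hεK)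

/-! ## §3 Stub C of `kriz-li-cover` (`stub_heegnerField_of_unitClassFactor`) -/

/-- **C ⟺ C in Bernoulli currency.** Left: `kriz-li-cover`'s `stub_heegnerField_of_unitClassFactor` VERBATIM (v2.1). Right: class data,
`r_an = 1`, `¬ ‖B_{p−k,χ_e}/(p−k)‖ ≤ p⁻¹` ⟹ there is an imaginary quadratic `K''` Heegner for `N_W` with `d` odd `< −4` and a Kronecker
character `ε_K` with `¬ ‖B_{k,(χ_e↑ε_K↑)~}/k‖ ≤ p⁻¹` — i.e. `p ∤ B_{k,χ_{e·d_{K''}}}/k`, the quantity of bsd-idea-7 g12's census (`m = k`).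
[cite: KrizLi2019, §8 (pp. 49–52) and Thm. 1.20 (p. 8)] [cite: Washington1997, Thm. 5.11 and Cor. 5.13] -/
theorem stubC_iff_bernoulli :
    (∀ (W : WeierstrassCurve ℚ) [W.IsElliptic] [W.IsGloballyMinimal] (p : ℕ) [Fact p.Prime], W.HasCM → CMRamified W p → 5 ≤ p →
      W.analyticRank = 1 → ∀ (f : ℕ) [NeZero f] (ψ : DirichletCharacter ℚ_[p] f) (ω : DirichletCharacter ℚ_[p] p), ψ.Odd →
      IsTeichmullerCharacter ω →
      (∀ ℓ : ℕ, ℓ.Prime → ¬ (ℓ ∣ p * W.conductorNorm ℤ) →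
        ‖((W.LFunction ℓ : ℤ) : ℚ_[p]) - (ψ (ℓ : ZMod f) + ψ⁻¹ (ℓ : ZMod f) * ω (ℓ : ZMod p))‖ < 1) →
      ¬ ‖bernoulliOnePrim ψ⁻¹‖ ≤ (p : ℝ)⁻¹ →
      ∃ (K : Type) (_ : Field K) (_ : NumberField K) (εK : DirichletCharacter ℚ_[p] (NumberField.discr K).natAbs),
        IsImaginaryQuadratic K ∧ SatisfiesHeegnerHypothesis (W.conductorNorm ℤ) K ∧ Odd (NumberField.discr K) ∧
        NumberField.discr K < -4 ∧ IsKroneckerCharacterOf K εK ∧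
        ¬ ‖bernoulliOnePrim (bernoulliCharTwo ψ εK ω)‖ ≤ (p : ℝ)⁻¹) ↔
    (∀ (W : WeierstrassCurve ℚ) [W.IsElliptic] [W.IsGloballyMinimal] (p : ℕ) [Fact p.Prime], W.HasCM → CMRamified W p → 5 ≤ p →
      W.analyticRank = 1 →
      ∀ (m : ℕ) [NeZero m] (χ : DirichletCharacter ℚ_[p] m) (ε : ℕ → ℤ) (k : ℕ),
        m.Coprime p → χ.IsPrimitive → χ.IsQuadratic → (∀ ℓ : ℕ, ℓ.Prime → ℓ ≠ p → χ (ℓ : ZMod m) = (ε ℓ : ℚ_[p])) →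
        2 ≤ k → k ≤ p - 2 → χ (-1) * (-1) ^ k = -1 →
        (∀ ℓ : ℕ, ℓ.Prime → ℓ ≠ p →
          ((W.LFunction ℓ : ℤ) : ZMod p) = (ε ℓ : ZMod p) * ((ℓ : ZMod p) ^ k + (ℓ : ZMod p) ^ (p - k))) →
        (∀ ℓ : ℕ, (hℓ : ℓ.Prime) → ℓ ≠ p → ¬ ℓ ∣ m → (haveI := Fact.mk hℓ; W.HasGoodReductionAtPrime ℓ)) →
        ¬ ‖((p - k : ℕ) : ℚ_[p])⁻¹ * generalizedBernoulli (p - k) χ‖ ≤ (p : ℝ)⁻¹ →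
        ∃ (K : Type) (_ : Field K) (_ : NumberField K) (εK : DirichletCharacter ℚ_[p] (NumberField.discr K).natAbs),
          IsImaginaryQuadratic K ∧ SatisfiesHeegnerHypothesis (W.conductorNorm ℤ) K ∧ Odd (NumberField.discr K) ∧
          NumberField.discr K < -4 ∧ IsKroneckerCharacterOf K εK ∧
          ¬ ‖(k : ℚ_[p])⁻¹ * @generalizedBernoulli ℚ_[p] _ _
              (changeLevel (dvd_mul_right m (NumberField.discr K).natAbs) χ *
                changeLevel (dvd_mul_left (NumberField.discr K).natAbs m) εK).conductor ⟨conductor_ne_zero _⟩ k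
              (changeLevel (dvd_mul_right m (NumberField.discr K).natAbs) χ *
                changeLevel (dvd_mul_left (NumberField.discr K).natAbs m) εK).primitiveCharacter‖ ≤ (p : ℝ)⁻¹) := by
  constructor
  · intro hC W _ _ p _ hCM hram h5 hr m _ χ ε k hmp hχ hχq hε hk2 hkp hpar htr hgoodW hcls
    have hp2 : p ≠ 2 := by omega
    haveI : NeZero (p * m) := ⟨Nat.mul_ne_zero (Fact.out : p.Prime).ne_zero (NeZero.ne m)⟩
    obtain ⟨ω, hω⟩ := exists_isTeichmullerCharacter (p := p)
    obtain ⟨-, hssc, -, -⟩ := KrizLiBinders.krizLiBinders_of_data hp2 W χ hχ hχq hmp ε hε hk2 hkp htr hgoodW ω hω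
    have hodd := KrizLiBinders.psi_odd_of ω χ k hp2 hω (by omega) hpar
    obtain ⟨K, iK, iK', εK, hK, hH, hoddK, hd4, hεK, hfld⟩ := hC W p hCM hram h5 hr (p * m) _ ω hodd hω hssc
      (fun h ↦ hcls ((norm_bernoulliOnePrim_inv_le_inv_iff_of_hss W χ ε k ω _ h5 hχ hχq hmp hε hk2 hkp hpar htr hgoodW hω
        hodd hssc).mp h))
    refine ⟨K, iK, iK', εK, hK, hH, hoddK, hd4, hεK, fun h ↦ hfld ?_⟩
    exact (norm_bernoulliOnePrim_bernoulliCharTwo_le_inv_iff_of_heegner W χ ε k ω _ hCM hram h5 hχ hχq hmp hε hk2 hkp hpar htr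
      hgoodW hω hodd hssc K hK hH εK).mpr h
  · intro hB W _ _ p _ hCM hram h5 hr f _ ψ ω hψ hω hss hcls
    obtain ⟨m, hm, χ, ε, k, hmp, hχ, hχq, hε, -, hk2, hkp, hpar, htr, hgoodW⟩ :=
      KrizLiBinders.exists_krizLiData_of_cmRamified W hCM hram h5
    haveI := hm
    obtain ⟨K, iK, iK', εK, hK, hH, hoddK, hd4, hεK, hfld⟩ := hB W p hCM hram h5 hr m χ ε k hmp hχ hχq (fun ℓ _ _ ↦ hε ℓ)
      hk2 hkp hpar htr hgoodW
      (fun h ↦ hcls ((norm_bernoulliOnePrim_inv_le_inv_iff_of_hss W χ ε k ω ψ h5 hχ hχq hmp (fun ℓ _ _ ↦ hε ℓ) hk2 hkp hpar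
        htr hgoodW hω hψ hss).mpr h))
    refine ⟨K, iK, iK', εK, hK, hH, hoddK, hd4, hεK, fun h ↦ hfld ?_⟩
    exact (norm_bernoulliOnePrim_bernoulliCharTwo_le_inv_iff_of_heegner W χ ε k ω ψ hCM hram h5 hχ hχq hmp (fun ℓ _ _ ↦ hε ℓ)
      hk2 hkp hpar htr hgoodW hω hψ hss K hK hH εK).mp h

end Summit.BirchSwinnertonDyer.BirchSwinnertonDyer.Theorems.PrintCFram.KummerDictionary

end
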